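import Summits.CriticalPhenomena.PercolationContinuityZ3.Theorems.Transplant.FKConnectivityAllQPat3CutOne
import HarnessLib

/-!
# Connectivity correlation inequalities for `φ_{w,q}`, every `q > 0` — the MARKED 1-CUT reduction (Stage S3, part 4): census
# g32's `c1_u··` step (the cut vertex is a mark) as a product-cone lemma

Definitions + theorems file (`--supports stmt-CriticalPhenomena-4575`), census lane `prim-bschramm-census` (gen 36) of the post-continuity programme (LANE 2 bschramm, FK sub-lane);
builds on p205010 (kernel theorem, internal audit signed; external expert review pending).
No named facts, no sorries; standard axioms.  `G = A ∪ B` meeting in ONE vertex `s` which IS a mark, the other marks `x ∈ A`,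
`y ∈ B`: `FK.tval_union2_cutS` (S1's `FK.pat3_union_serS` + fk-2's `FK.apExp_series`; both sides are read as bits, on
`(x, s, s)` and `(s, y, y)`), `FK.joinS3`, `FK.hdec_cutS`, **`FK.cutS_level_nonneg_of_symCert`**.  Since both sides enter only
through bit indicators, the data files need NO hypothesis: `T_sym`/`STAR ≥ 0` levelwise whenever a mark separates the other
two (any graphs `A`, `B`).
[cite: AyyerLinussonRavichandran2025, §7 eq. (13)–(15) (p. 22)] [cite: Grimmett2006, §3.8 (pp. 61–62)]
-/

noncomputable section

namespace Summit.CriticalPhenomena.PercolationContinuityZ3.Theorems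

namespace FK

open SimpleGraph Literature.Probability.LatticeModels Literature.Probability.Percolation

/-! ### The MARKED 1-CUT configuration (census g32 §4 `c1_u··`): the mark `s` is a cut vertex separating the marks `x ∈ A`, `y ∈ B` -/

/-- MARKED-1-CUT join read as a three-piece law: the series join at the mark of the two sides' bits `x ~ s` (side `A` read on
`(x, s, s)`) and `s ~ y` (side `B` read on `(s, y, y)`); the (empty) third piece is ignored. [folklore] -/
def joinS3 (P1 P2 _P3 : Pat3) : Pat3 := joinSerS P1.xy P2.xy

section CutMarked

open scoped Classical

variable {V : Type*} [Fintype V] {E₁ E₂ : Finset (Sym2 V)} {V₁ V₂ : Set V} {s : V}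

/-- **BILINEAR DECOMPOSITION OF `tval` OVER A MARKED 1-CUT** (series gluing AT the mark `s`; marks `x ∈ A`, `y ∈ B`; composite
read on `(x, y, s)`): S1's `FK.pat3_union_serS` with fk-2's `FK.apExp_series`. [folklore] -/
theorem tval_union2_cutS (hd : Disjoint E₁ E₂) (h₁ : ∀ e ∈ (↑E₁ : Set (Sym2 V)), ∀ z ∈ e, z ∈ V₁)
    (h₂ : ∀ e ∈ (↑E₂ : Set (Sym2 V)), ∀ z ∈ e, z ∈ V₂) (hS : V₁ ∩ V₂ ⊆ ({s} : Set V)) {x y : V} (hxV : x ∉ V₂)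
    (hyV : y ∉ V₁) (hxs : x ≠ s) (hys : y ≠ s) (hxy : x ≠ y) (wt : ℕ → ℝ) (tab : Pat3 → Pat3 → ℤ) :
    tval (fun n => wt (n + 2 * Fintype.card V)) (E₁ ∪ E₂) x y s tab =
      ∑ γ₁ ∈ E₁.powerset, ∑ γ₂ ∈ E₂.powerset,
        wt (apExp E₁ γ₁ + apExp E₂ γ₂) *
          (tab (joinSerS (pat3 γ₁ x s s).xy (pat3 γ₂ s y y).xy)
            (joinSerS (pat3 (E₁ \ γ₁) x s s).xy (pat3 (E₂ \ γ₂) s y y).xy) : ℝ) := by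
  unfold tval
  beta_reduce
  rw [sum_powerset_union_disj hd]
  refine Finset.sum_congr rfl fun γ₁ hγ₁ => Finset.sum_congr rfl fun γ₂ hγ₂ => ?_
  have g₁ := Finset.mem_powerset.1 hγ₁
  have g₂ := Finset.mem_powerset.1 hγ₂
  rw [union_sdiff_union hd g₁ g₂, apExp_series hd h₁ h₂ hS le_rfl le_rfl g₁ g₂,
    pat3_union_serS h₁ h₂ hS hxV hyV hxs hys hxy g₁ g₂,
    pat3_union_serS h₁ h₂ hS hxV hyV hxs hys hxy Finset.sdiff_subset Finset.sdiff_subset, pat3_xy, pat3_xy, pat3_xy, pat3_xy]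

/-- The MARKED-1-CUT decomposition in the three-piece shape (sides read on `(x, s, s)` and `(s, y, y)`, empty third piece,
offset `4|V|`). [folklore] -/
theorem hdec_cutS (hd : Disjoint E₁ E₂) (h₁ : ∀ e ∈ (↑E₁ : Set (Sym2 V)), ∀ z ∈ e, z ∈ V₁)
    (h₂ : ∀ e ∈ (↑E₂ : Set (Sym2 V)), ∀ z ∈ e, z ∈ V₂) (hS : V₁ ∩ V₂ ⊆ ({s} : Set V)) {x y : V} (hxV : x ∉ V₂)
    (hyV : y ∉ V₁) (hxs : x ≠ s) (hys : y ≠ s) (hxy : x ≠ y) (wt : ℕ → ℝ) (tab : Pat3 → Pat3 → ℤ) :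
    tval (fun n => wt (n + 4 * Fintype.card V)) (E₁ ∪ E₂) x y s tab =
      ∑ γ₁ ∈ E₁.powerset, ∑ γ₂ ∈ E₂.powerset, ∑ γ₃ ∈ (∅ : Finset (Sym2 V)).powerset,
        wt (apExp E₁ γ₁ + apExp E₂ γ₂ + apExp ∅ γ₃ + corrR3 (pat3 γ₁ x s s) (pat3 γ₂ s y y) (pat3 γ₃ x s s) +
            corrR3 (pat3 (E₁ \ γ₁) x s s) (pat3 (E₂ \ γ₂) s y y) (pat3 (∅ \ γ₃) x s s)) *
          (tab (joinS3 (pat3 γ₁ x s s) (pat3 γ₂ s y y) (pat3 γ₃ x s s))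
            (joinS3 (pat3 (E₁ \ γ₁) x s s) (pat3 (E₂ \ γ₂) s y y) (pat3 (∅ \ γ₃) x s s)) : ℝ) := by
  have h2 := tval_union2_cutS hd h₁ h₂ hS hxV hyV hxs hys hxy (fun m => wt (m + 2 * Fintype.card V)) tab
  beta_reduce at h2
  have e : (fun n => wt (n + 4 * Fintype.card V)) = fun n => wt (n + 2 * Fintype.card V + 2 * Fintype.card V) := by
    funext n
    congr 1
    ring
  rw [e, h2]
  refine Finset.sum_congr rfl fun γ₁ _ => Finset.sum_congr rfl fun γ₂ _ => ?_
  simp only [Finset.powerset_empty, Finset.sum_singleton, apExp_empty, joinS3, corrR3, add_zero]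

/-- **The MARKED-1-CUT product-cone lemma** (census g32's `c1_u··` reductions): for `G = A ∪ B` meeting in the single MARKED
vertex `s`, marks `x ∈ A`, `y ∈ B`, a target `T` on `(x, y, s)` and a product family dominated (after symmetrisation) through
`joinS3`/`corrR3` whose generators are levelwise nonnegative on `A` read on `(x, s, s)`, on `B` read on `(s, y, y)` and on the
empty piece (bit indicators and `one2` are, coefficientwise — so NO induction hypothesis is needed), `0 ≤ D · lev2 G x y s T λ`.
[cite: AyyerLinussonRavichandran2025, §7 (p. 22)] -/
theorem cutS_level_nonneg_of_symCert (hd : Disjoint E₁ E₂) (h₁ : ∀ e ∈ (↑E₁ : Set (Sym2 V)), ∀ z ∈ e, z ∈ V₁)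
    (h₂ : ∀ e ∈ (↑E₂ : Set (Sym2 V)), ∀ z ∈ e, z ∈ V₂) (hS : V₁ ∩ V₂ ⊆ ({s} : Set V)) {x y : V} (hxV : x ∉ V₂)
    (hyV : y ∉ V₁) (hxs : x ≠ s) (hys : y ≠ s) (hxy : x ≠ y)
    (T : ℕ → Pat3 → Pat3 → ℤ) (D : ℕ) {ι : Type*} (J : Finset ι) (prod : ι → Prod3)
    (hcert : ∀ d : ℕ, ∀ P1 Q1 P2 Q2 P3 Q3 : Pat3,
      8 * ∑ j ∈ J, ((prod j).lam : ℤ) * (prod j).tensor d P1 Q1 P2 Q2 P3 Q3 ≤ D * target3Sym joinS3 corrR3 T d P1 Q1 P2 Q2 P3 Q3)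
    (hval : ∀ j ∈ J, ∀ μ : ℕ, 0 ≤ lev2 E₁ x s s (prod j).gK μ ∧ 0 ≤ lev2 E₂ s y y (prod j).g1 μ ∧
      0 ≤ lev2 (∅ : Finset (Sym2 V)) x s s (prod j).g2 μ)
    (lam : ℕ) : 0 ≤ (D : ℤ) * lev2 (E₁ ∪ E₂) x y s T lam :=
  cone3_level_nonneg_sym (EK := E₁) (E₁ := E₂) (E₂ := (∅ : Finset (Sym2 V))) (uK := x) (vK := s) (mK := s)
    (u₁ := s) (v₁ := y) (m₁ := y) (u₂ := x) (v₂ := s) (m₂ := s) joinS3 corrR3 (4 * Fintype.card V)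
    (fun wt tab => hdec_cutS hd h₁ h₂ hS hxV hyV hxs hys hxy wt tab) T D J prod hcert hval lam

end CutMarked

end FK

end Summit.CriticalPhenomena.PercolationContinuityZ3.Theorems

end
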